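import Summits.CriticalPhenomena.PercolationContinuityZ3.Theorems.PercNearOneGluingNoHeavyLowerTailStarSetFamilyA0
import Summits.CriticalPhenomena.PercolationContinuityZ3.Theorems.PercNearOneGluingNoHeavyLowerTailStarSetSwapFibre
import Summits.CriticalPhenomena.PercolationContinuityZ3.Theorems.PercNearOneGluingNoHeavyLowerTailStarSetOmegaStar
import HarnessLib

/-!
# `NoHeavyLowerTail` (stmt-CriticalPhenomena-4575) — small discharge lemmas for the early families (blueprint §G5)

Support file (prover `prim-gen-swap` gen 13; `--supports stmt-CriticalPhenomena-4575`).  No definitions, no named facts, no sorries.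

* `StarSet.familyA0_of_units` — `familyA0_bound` from the assembly's unit data (adjacency stated from the configuration side);
* `StarSet.rclass_eq_of_ports` — two classes with the same ports `{r, d}` coincide (distinct port pairs): the child edge at `d` is unique, so the
  swap target's new class depends on the port only;
* `StarSet.swap_no_three` — no three distinct classes through `d` are adjacent to a class avoiding `d` (from `swap_fibre_card_le_two`): at most two
  swap units per target;
* `StarSet.swap_child_not_mem_of_star`, `StarSet.swap_hcase_star` (appended) — in a non-A0 configuration whose Ω has ≥ 2 classes every class passes
  through one port `v ≠ r` (`omega_star_of_no_triangle`); hence the child edge `{r,d}` of a swap port with a `d`-avoiding class is not in `S`, and the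
  STAR disjunct of `swap_targets_one_port`'s `hcase` holds.
-/

namespace Summit.CriticalPhenomena.PercolationContinuityZ3.Theorems

open Finset
open scoped BigOperators Classical

namespace StarSet

variable {ι V : Type*} [Fintype ι] [DecidableEq ι] [DecidableEq V]

/-- **The A0 family from the unit data.** -/
theorem familyA0_of_units [Fintype V] (P P' : ι → V) (hPP' : ∀ X, P X ≠ P' X)
    (hinj : Function.Injective fun X => (s(P X, P' X) : Sym2 V)) (r : V)
    (θ : ι → ℝ) (hθ0 : ∀ X, 0 ≤ θ X) (hθ1 : ∀ X, θ X ≤ 1) (O : ι → V → ℝ) (hO0 : ∀ X d, 0 ≤ O X d) (Φ : ι → ℝ)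
    (hO2 : ∀ X, Φ X ^ 2 ≤ O X (P X) * O X (P' X)) (hΦ4 : ∀ X, 4 * θ X ≤ Φ X)
    (U : Finset (Finset ι × ι))
    (hU : ∀ u ∈ U, u.2 ∈ u.1 ∧ (∀ Y ∈ u.1, P Y = P u.2 ∨ P Y = P' u.2 ∨ P' Y = P u.2 ∨ P' Y = P' u.2) ∧
      ∃ a b c : V, a ≠ b ∧ a ≠ c ∧ b ≠ c ∧ a ≠ r ∧ b ≠ r ∧ c ≠ r ∧
        (∃ X ∈ u.1, (s(P X, P' X) : Sym2 V) = s(a, b)) ∧ (∃ Y ∈ u.1, (s(P Y, P' Y) : Sym2 V) = s(a, c)) ∧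
          ∃ Z ∈ u.1, (s(P Z, P' Z) : Sym2 V) = s(b, c)) :
    ∑ u ∈ U, ((∏ k ∈ u.1, θ k) * ∏ k ∈ univ \ u.1, (1 - θ k)) ≤
      (3 / 128) * ∑ T ∈ (univ : Finset ι).powerset.filter (fun T => ∃ a b c : V, ∃ X Y Z : ι,
          a ≠ b ∧ a ≠ c ∧ b ≠ c ∧ a ≠ r ∧ b ≠ r ∧ c ≠ r ∧ T = {X, Y, Z} ∧
          (s(P X, P' X) : Sym2 V) = s(a, b) ∧ (s(P Y, P' Y) : Sym2 V) = s(a, c) ∧ (s(P Z, P' Z) : Sym2 V) = s(b, c)),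
        ∑ δ ∈ (univ : Finset (ι → Bool)).filter (fun δ => (∀ K ∉ T, δ K = false) ∧
            3 ≤ (T.image fun K => if δ K then P K else P' K).card ∧ r ∉ T.image fun K => if δ K then P K else P' K),
          ∏ K ∈ T, O K (if δ K then P K else P' K) := by
  refine familyA0_bound P P' hPP' hinj r θ hθ0 hθ1 O hO0 Φ hO2 hΦ4 U fun u hu => ?_
  obtain ⟨hX, hadj, htri⟩ := hU u hu
  refine ⟨hX, fun Y hY => ?_, htri⟩
  rcases hadj Y hY with h | h | h | h
  · exact Or.inl h.symm
  · exact Or.inr (Or.inr (Or.inl h.symm))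
  · exact Or.inr (Or.inl h.symm)
  · exact Or.inr (Or.inr (Or.inr h.symm))

omit [Fintype ι] [DecidableEq ι] [DecidableEq V] in
/-- **Classes with the same two ports coincide** (distinct port pairs); in particular the child edge `{r, d}` is unique. -/
theorem rclass_eq_of_ports (P P' : ι → V) (hinj : Function.Injective fun X => (s(P X, P' X) : Sym2 V))
    {I I' : ι} {r d : V} (hI : P I = r ∧ P' I = d) (hI' : P I' = r ∧ P' I' = d) : I = I' := by
  apply hinj
  show (s(P I, P' I) : Sym2 V) = s(P I', P' I')
  rw [hI.1, hI.2, hI'.1, hI'.2]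

omit [DecidableEq ι] in
/-- **At most two swap units per target**: no three distinct classes through `d` are all adjacent to a class avoiding `d`. -/
theorem swap_no_three (P P' : ι → V) (hinj : Function.Injective fun X => (s(P X, P' X) : Sym2 V))
    {d : V} {Y : ι} (hYd : P Y ≠ d ∧ P' Y ≠ d) {X₁ X₂ X₃ : ι} (h12 : X₁ ≠ X₂) (h13 : X₁ ≠ X₃) (h23 : X₂ ≠ X₃)
    (h₁ : (P X₁ = d ∨ P' X₁ = d) ∧ (P X₁ = P Y ∨ P X₁ = P' Y ∨ P' X₁ = P Y ∨ P' X₁ = P' Y))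
    (h₂ : (P X₂ = d ∨ P' X₂ = d) ∧ (P X₂ = P Y ∨ P X₂ = P' Y ∨ P' X₂ = P Y ∨ P' X₂ = P' Y))
    (h₃ : (P X₃ = d ∨ P' X₃ = d) ∧ (P X₃ = P Y ∨ P X₃ = P' Y ∨ P' X₃ = P Y ∨ P' X₃ = P' Y)) : False := by
  classical
  have hle := swap_fibre_card_le_two P P' hinj d Y hYd
  have hsub : ({X₁, X₂, X₃} : Finset ι) ⊆ univ.filter (fun X => (P X = d ∨ P' X = d) ∧
      (P X = P Y ∨ P X = P' Y ∨ P' X = P Y ∨ P' X = P' Y)) := by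
    intro X hX
    rw [mem_filter]
    refine ⟨mem_univ _, ?_⟩
    rcases mem_insert.1 hX with rfl | hX
    · exact h₁
    rcases mem_insert.1 hX with rfl | hX
    · exact h₂
    · rw [mem_singleton.1 hX]; exact h₃
  have h3 : ({X₁, X₂, X₃} : Finset ι).card = 3 := by
    rw [card_insert_of_notMem (by simp [h12, h13]), card_pair h23]
  have := card_le_card hsub
  omega

omit [Fintype ι] [DecidableEq ι] in
/-- **The child edge of a swap port is not in the configuration (case `|Ω| ≥ 2`).**  If `Ω ⊆ S` has two r-free classes adjacent to all of `S`,
`S` contains no r-free triangle, `A ∈ S` has ports `(r, d)` and some class of `S` avoids `d`: contradiction (all of `S` passes through `d`). -/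
theorem swap_child_not_mem_of_star (P P' : ι → V) (hPP' : ∀ X, P X ≠ P' X)
    (hinj : Function.Injective fun X => (s(P X, P' X) : Sym2 V)) (r : V) (S Ω : Finset ι) (hΩS : Ω ⊆ S)
    (hcard : 2 ≤ Ω.card) (hΩr : ∀ X ∈ Ω, P X ≠ r ∧ P' X ≠ r)
    (hadj : ∀ X ∈ Ω, ∀ Y ∈ S, P X = P Y ∨ P X = P' Y ∨ P' X = P Y ∨ P' X = P' Y)
    (hnotri : ¬ ∃ a b c : V, a ≠ b ∧ a ≠ c ∧ b ≠ c ∧ a ≠ r ∧ b ≠ r ∧ c ≠ r ∧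
      (∃ X ∈ S, (s(P X, P' X) : Sym2 V) = s(a, b)) ∧ (∃ Y ∈ S, (s(P Y, P' Y) : Sym2 V) = s(a, c)) ∧
        ∃ Z ∈ S, (s(P Z, P' Z) : Sym2 V) = s(b, c))
    {A : ι} (hAS : A ∈ S) {d : V} (hA : P A = r ∧ P' A = d) {Y : ι} (hYS : Y ∈ S) (hYd : P Y ≠ d ∧ P' Y ≠ d) : False := by
  obtain ⟨v, hvr, -, hall⟩ := omega_star_of_no_triangle P P' hPP' hinj r S Ω hΩS hcard hΩr hadj hnotri
  have hvd : v = d := by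
    rcases hall A hAS with h | h
    · exact absurd (h.symm.trans hA.1) hvr
    · exact h.symm.trans hA.2
  rcases hall Y hYS with h | h
  · exact hYd.1 (h.trans hvd)
  · exact hYd.2 (h.trans hvd)

omit [Fintype ι] [DecidableEq ι] in
/-- **The STAR disjunct of `swap_targets_one_port`'s case hypothesis** for a configuration whose Ω (r-free chords adjacent to everything) has
≥ 2 classes and which contains no r-free triangle. -/
theorem swap_hcase_star (P P' : ι → V) (hPP' : ∀ X, P X ≠ P' X)
    (hinj : Function.Injective fun X => (s(P X, P' X) : Sym2 V)) (r : V) (F : Finset ι) (S Ω : Finset ι) (hΩS : Ω ⊆ S)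
    (hcard : 2 ≤ Ω.card) (hΩr : ∀ X ∈ Ω, P X ≠ r ∧ P' X ≠ r) (hΩF : ∀ X ∈ Ω, X ∉ F)
    (hadj : ∀ X ∈ Ω, ∀ Y ∈ S, P X = P Y ∨ P X = P' Y ∨ P' X = P Y ∨ P' X = P' Y)
    (hnotri : ¬ ∃ a b c : V, a ≠ b ∧ a ≠ c ∧ b ≠ c ∧ a ≠ r ∧ b ≠ r ∧ c ≠ r ∧
      (∃ X ∈ S, (s(P X, P' X) : Sym2 V) = s(a, b)) ∧ (∃ Y ∈ S, (s(P Y, P' Y) : Sym2 V) = s(a, c)) ∧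
        ∃ Z ∈ S, (s(P Z, P' Z) : Sym2 V) = s(b, c))
    (X : ι) :
    ∃ v, v ≠ r ∧ (∀ Y ∈ S, P Y = v ∨ P' Y = v) ∧ ∃ X' ∈ S, X' ≠ X ∧ X' ∉ F := by
  obtain ⟨v, hvr, -, hall⟩ := omega_star_of_no_triangle P P' hPP' hinj r S Ω hΩS hcard hΩr hadj hnotri
  obtain ⟨X', hX', hne⟩ : ∃ X' ∈ Ω, X' ≠ X := by
    by_contra h
    push Not at h
    have : Ω ⊆ {X} := fun K hK => mem_singleton.2 (h K hK)
    have := card_le_card this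
    rw [card_singleton] at this
    omega
  exact ⟨v, hvr, hall, X', hΩS hX', hne, hΩF X' hX'⟩

end StarSet

end Summit.CriticalPhenomena.PercolationContinuityZ3.Theorems
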